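import Mathlib
import HarnessLib
import Summits.MatrixMultiplication.MatrixMultiplication.Theorems.OutsiderSandwichToricCeilingPowMixedPure
import Summits.MatrixMultiplication.MatrixMultiplication.Theorems.OutsiderSandwichToricCeilingPowMixedStar

/-!
# OutsiderSandwich — mixed-basis toric ceiling `⟨3^N - 2⟩`, part 6: the SPREAD slice
(decomp-mm lens 4, gen 46, kernel K46-6; THESES-FREE, `ω`-free; helper toward `LaserTangency`,
stmt-32268 — the extremal subrank/packing cells of the literal host `kroneckerPow (cwTensor ℂ 2) N`)

LABEL.  TORIC · uniform in `N` · NEC-side instrument (a slice construction of the mixed machine;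
the theorem is assembled in a later part); the rates, the crux `h₁ = LaserTangency` and the route's
`closes` are untouched.

WHAT.  The SPREAD slice of `…PowSubTwoSpread` (tight frame) ported to a product frame `frame κ` with
cw coordinates, at a PERMUTATION pivot `p` where no pair is doubled: `spread_core` — slot `ξ` is a
STAR (`…PowMixedStar.hasPM_star`), slots `ξ + e`, `ξ + 2e` are co-size-2 tail instances (induction
hypothesis `ih`, two-basis law `lawκ`), plus three auxiliary triples of direction `2e` whose tails
come from the two-basis rule `…PowMixedRules.spκ` (selector `ρ`; the flags are read at ONE
permutation tail coordinate `j₀` where no pair is doubled).  `twoPMκ_spread`: switching the rule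
at `j₀` (a permutation coordinate, where `spκ` is the tight rule `spRule` and the two rules differ,
`…PowSubTwoSpread.sp_diff`) gives a second, distinct matching.
-/

set_option linter.dupNamespace false

namespace Summit.MatrixMultiplication.MatrixMultiplication.Theorems.OutsiderSandwichToricCeilingPowMixedSpread

open Finset
open Summit.MatrixMultiplication.MatrixMultiplication.Theorems.OutsiderSandwichToricCeilingPowFibres
  (Word Tr3 slotB frame)
open Summit.MatrixMultiplication.MatrixMultiplication.Theorems.OutsiderSandwichToricCeilingPowSubTwoGlue
open Summit.MatrixMultiplication.MatrixMultiplication.Theorems.OutsiderSandwichToricCeilingPowSubTwoRules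
open Summit.MatrixMultiplication.MatrixMultiplication.Theorems.OutsiderSandwichToricCeilingPowSubTwoSpread
  (spA₁ spB₁ spC₁ spA₂ spB₂ spC₂ spA₃ spB₃ spC₃ sp_diff)
open Summit.MatrixMultiplication.MatrixMultiplication.Theorems.OutsiderSandwichToricCeilingPowMixedGlue
open Summit.MatrixMultiplication.MatrixMultiplication.Theorems.OutsiderSandwichToricCeilingPowMixedRules
open Summit.MatrixMultiplication.MatrixMultiplication.Theorems.OutsiderSandwichToricCeilingPowMixedPure
  (puLet puLet_apply injOn_quad)
open Summit.MatrixMultiplication.MatrixMultiplication.Theorems.OutsiderSandwichToricCeilingPowMixedStar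
  (hasPM_star)

variable {m : ℕ}

/-! ## §1 Auxiliary triples of the SPREAD slice -/

/-- The three auxiliary triples of the SPREAD slice at pivot `p` (letters `ξ, ξ+e, ξ+2e`, basis
vector `κ`, rule selector `ρ`): `T_ξ ∈ (ξ, ξ+2e, ξ+e)`, `T_η ∈ (ξ+e, ξ, ξ+2e)`,
`T_ζ ∈ (ξ+2e, ξ+e, ξ)`; tails by the two-basis rule `spκ` (evaluated coordinatewise by
`…PowMixedPure.puLet`). [new] -/
def spTκ (p : Fin (m + 1)) (ξ e : Fin 3) (κ : Fin (m + 1) → Bool) (ρ : Fin m → Bool)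
    (xe xz yx yz zx ze : Word (m + 1)) : Finset (Tr3 (m + 1)) :=
  {(ins p ξ (puLet spκA₁ p κ ρ xe xz yx yz zx ze),
      ins p (ξ + e + e) (puLet spκB₁ p κ ρ xe xz yx yz zx ze),
      ins p (ξ + e) (puLet spκC₁ p κ ρ xe xz yx yz zx ze)),
    (ins p (ξ + e) (puLet spκA₂ p κ ρ xe xz yx yz zx ze),
      ins p ξ (puLet spκB₂ p κ ρ xe xz yx yz zx ze),
      ins p (ξ + e + e) (puLet spκC₂ p κ ρ xe xz yx yz zx ze)),
    (ins p (ξ + e + e) (puLet spκA₃ p κ ρ xe xz yx yz zx ze),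
      ins p (ξ + e) (puLet spκB₃ p κ ρ xe xz yx yz zx ze),
      ins p ξ (puLet spκC₃ p κ ρ xe xz yx yz zx ze))}

/-- Every auxiliary SPREAD triple has direction `2e`. -/
theorem spTκ_dir {p : Fin (m + 1)} {ξ e : Fin 3} {κ : Fin (m + 1) → Bool} {ρ : Fin m → Bool}
    {xe xz yx yz zx ze : Word (m + 1)} {t : Tr3 (m + 1)}
    (ht : t ∈ spTκ p ξ e κ ρ xe xz yx yz zx ze) : t.2.1 p = t.1 p + (e + e) := by
  simp only [spTκ, mem_insert, mem_singleton] at ht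
  rcases ht with rfl | rfl | rfl <;> simp only [ins_apply_same] <;>
    first | exact (F3.dir2 _ _).1 | exact (F3.dir2 _ _).2.1

/-- At a permutation coordinate the two-basis SPREAD rules are the tight rules, which never produce
the same three auxiliary rows (`…PowSubTwoSpread.sp_diff`). -/
theorem spκ_diff (xe xz yx yz zx ze : Fin 3) (h : twice xe xz yx yz zx ze = true) (h₁ : xe ≠ xz)
    (h₂ : yx ≠ yz) (h₃ : zx ≠ ze) :
    ¬ (spκA₁ false false xe xz yx yz zx ze = spκA₁ false true xe xz yx yz zx ze ∧
      spκB₁ false false xe xz yx yz zx ze = spκB₁ false true xe xz yx yz zx ze ∧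
      spκC₁ false false xe xz yx yz zx ze = spκC₁ false true xe xz yx yz zx ze ∧
      spκA₂ false false xe xz yx yz zx ze = spκA₂ false true xe xz yx yz zx ze ∧
      spκB₂ false false xe xz yx yz zx ze = spκB₂ false true xe xz yx yz zx ze ∧
      spκC₂ false false xe xz yx yz zx ze = spκC₂ false true xe xz yx yz zx ze ∧
      spκA₃ false false xe xz yx yz zx ze = spκA₃ false true xe xz yx yz zx ze ∧
      spκB₃ false false xe xz yx yz zx ze = spκB₃ false true xe xz yx yz zx ze ∧
      spκC₃ false false xe xz yx yz zx ze = spκC₃ false true xe xz yx yz zx ze) :=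
  sp_diff xe xz yx yz zx ze h h₁ h₂ h₃

/-! ## §2 The SPREAD core -/

/-- SPREAD CORE in a product frame at a permutation pivot `p` with letters `x ↦ {ξ+e, ξ+2e}`,
`y ↦ {ξ, ξ+2e}`, `z ↦ {ξ, ξ+e}`, and no doubled pair at any permutation tail coordinate.  Primary
direction `e`: slot `ξ` is a star, slots `ξ+e`, `ξ+2e` are co-size-2 tail instances (`ih`), plus
the three auxiliary triples `spTκ` (rule selector `ρ`; flags from the permutation tail coordinate
`j₀`).  The auxiliary triples are recovered from the matching as its triples of direction `2e`. -/
theorem spread_core {p : Fin (m + 1)} {κ : Fin (m + 1) → Bool} (hp : κ p = false)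
    (hκ₁ : ∀ i j, tailκ p κ i = true → tailκ p κ j = true → i = j)
    (ih : ∀ x₁ x₂ y₁ y₂ z₁ z₂ : Word m, x₁ ≠ x₂ → y₁ ≠ y₂ → z₁ ≠ z₂ →
      (∀ j, lawκ (tailκ p κ j) (x₁ j) (x₂ j) (y₁ j) (y₂ j) (z₁ j) (z₂ j) = true) →
      ∃ P, isPMκ (tailκ p κ) P {x₁, x₂} {y₁, y₂} {z₁, z₂} = true)
    (j₀ : Fin m) (hj₀ : κ (p.succAbove j₀) = false) {ξ e : Fin 3} (he : e ≠ 0) (ρ : Fin m → Bool)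
    {xe xz yx yz zx ze : Word (m + 1)} (hXe : xe p = ξ + e) (hXz : xz p = ξ + e + e)
    (hYx : yx p = ξ) (hYz : yz p = ξ + e + e) (hZx : zx p = ξ) (hZe : ze p = ξ + e)
    (hadm : ∀ j, lawκ (κ (p.succAbove j)) (xe (p.succAbove j)) (xz (p.succAbove j))
      (yx (p.succAbove j)) (yz (p.succAbove j)) (zx (p.succAbove j)) (ze (p.succAbove j)) = true)
    (hsp : ∀ j, κ (p.succAbove j) = false → xe (p.succAbove j) ≠ xz (p.succAbove j) ∧
      yx (p.succAbove j) ≠ yz (p.succAbove j) ∧ zx (p.succAbove j) ≠ ze (p.succAbove j)) :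
    ∃ P, isPMκ κ P {xe, xz} {yx, yz} {zx, ze} = true ∧ spTκ p ξ e κ ρ xe xz yx yz zx ze ⊆ P ∧
      ∀ t ∈ P, t.2.1 p = t.1 p + (e + e) → t ∈ spTκ p ξ e κ ρ xe xz yx yz zx ze := by
  obtain ⟨n₁, n₂, n₃⟩ := F3.lift_ne ξ e he
  have h3 : ξ + e + e + e = ξ := F3.add3 ξ e
  have H := fun j => spκ_spec (κ (p.succAbove j)) (ρ j) (xe (p.succAbove j)) (xz (p.succAbove j))
    (yx (p.succAbove j)) (yz (p.succAbove j)) (zx (p.succAbove j)) (ze (p.succAbove j)) (hadm j)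
    (hsp j)
  -- the nine tail words
  obtain ⟨A₁, hA₁⟩ : ∃ w : Word m, w = puLet spκA₁ p κ ρ xe xz yx yz zx ze := ⟨_, rfl⟩
  obtain ⟨B₁, hB₁⟩ : ∃ w : Word m, w = puLet spκB₁ p κ ρ xe xz yx yz zx ze := ⟨_, rfl⟩
  obtain ⟨C₁, hC₁⟩ : ∃ w : Word m, w = puLet spκC₁ p κ ρ xe xz yx yz zx ze := ⟨_, rfl⟩
  obtain ⟨A₂, hA₂⟩ : ∃ w : Word m, w = puLet spκA₂ p κ ρ xe xz yx yz zx ze := ⟨_, rfl⟩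
  obtain ⟨B₂, hB₂⟩ : ∃ w : Word m, w = puLet spκB₂ p κ ρ xe xz yx yz zx ze := ⟨_, rfl⟩
  obtain ⟨C₂, hC₂⟩ : ∃ w : Word m, w = puLet spκC₂ p κ ρ xe xz yx yz zx ze := ⟨_, rfl⟩
  obtain ⟨A₃, hA₃⟩ : ∃ w : Word m, w = puLet spκA₃ p κ ρ xe xz yx yz zx ze := ⟨_, rfl⟩
  obtain ⟨B₃, hB₃⟩ : ∃ w : Word m, w = puLet spκB₃ p κ ρ xe xz yx yz zx ze := ⟨_, rfl⟩
  obtain ⟨C₃, hC₃⟩ : ∃ w : Word m, w = puLet spκC₃ p κ ρ xe xz yx yz zx ze := ⟨_, rfl⟩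
  -- rows lie in the tail frame
  have R₁ : ((A₁, B₁, C₁) : Tr3 m) ∈ frame (tailκ p κ) := by
    rw [mem_frame]; intro j; rw [hA₁, hB₁, hC₁]; exact (H j).1
  have R₂ : ((A₂, B₂, C₂) : Tr3 m) ∈ frame (tailκ p κ) := by
    rw [mem_frame]; intro j; rw [hA₂, hB₂, hC₂]; exact (H j).2.1
  have R₃ : ((A₃, B₃, C₃) : Tr3 m) ∈ frame (tailκ p κ) := by
    rw [mem_frame]; intro j; rw [hA₃, hB₃, hC₃]; exact (H j).2.2.1
  have Fst : ∀ j, A₁ j ≠ B₃ j ∧ B₃ j ≠ C₂ j ∧ A₁ j ≠ C₂ j := fun j => by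
    rw [hA₁, hB₃, hC₂]; exact (H j).2.2.2.1
  have Fη : ∀ j, lawκ (tailκ p κ j) (tl p xe j) (A₂ j) (tl p yz j) (B₁ j) (tl p zx j) (C₃ j)
      = true := fun j => by rw [hA₂, hB₁, hC₃]; exact (H j).2.2.2.2.1
  have Fζ : ∀ j, lawκ (tailκ p κ j) (tl p xz j) (A₃ j) (tl p yx j) (B₂ j) (tl p ze j) (C₁ j)
      = true := fun j => by rw [hA₃, hB₂, hC₁]; exact (H j).2.2.2.2.2.1
  -- the flags, from the permutation tail coordinate `j₀`
  have Fl := (H j₀).2.2.2.2.2.2 hj₀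
  have G1 : tl p xe ≠ A₂ := fun eq => Fl.1 (by
    have h := congrFun eq j₀; rw [hA₂] at h; exact h.symm)
  have G2 : tl p xz ≠ A₃ := fun eq => Fl.2.1 (by
    have h := congrFun eq j₀; rw [hA₃] at h; exact h.symm)
  have G3 : tl p yz ≠ B₁ := fun eq => Fl.2.2.1 (by
    have h := congrFun eq j₀; rw [hB₁] at h; exact h.symm)
  have G4 : tl p yx ≠ B₂ := fun eq => Fl.2.2.2.1 (by
    have h := congrFun eq j₀; rw [hB₂] at h; exact h.symm)
  have G5 : tl p zx ≠ C₃ := fun eq => Fl.2.2.2.2.1 (by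
    have h := congrFun eq j₀; rw [hC₃] at h; exact h.symm)
  have G6 : tl p ze ≠ C₁ := fun eq => Fl.2.2.2.2.2 (by
    have h := congrFun eq j₀; rw [hC₁] at h; exact h.symm)
  -- the three sub-matchings: a star in slot `ξ`, induction in the two other slots
  obtain ⟨Qξ, hQξ⟩ := hasPM_star m (tailκ p κ) hκ₁ A₁ B₃ C₂ Fst
  obtain ⟨Qη, hQη⟩ := ih (tl p xe) A₂ (tl p yz) B₁ (tl p zx) C₃ G1 G3 G5 Fη
  obtain ⟨Qζ, hQζ⟩ := ih (tl p xz) A₃ (tl p yx) B₂ (tl p ze) C₁ G2 G4 G6 Fζ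
  -- the auxiliary triples
  obtain ⟨T₁, hT₁⟩ : ∃ T : Tr3 (m + 1), T = (ins p ξ A₁, ins p (ξ + e + e) B₁, ins p (ξ + e) C₁) :=
    ⟨_, rfl⟩
  obtain ⟨T₂, hT₂⟩ : ∃ T : Tr3 (m + 1), T = (ins p (ξ + e) A₂, ins p ξ B₂, ins p (ξ + e + e) C₂) :=
    ⟨_, rfl⟩
  obtain ⟨T₃, hT₃⟩ : ∃ T : Tr3 (m + 1), T = (ins p (ξ + e + e) A₃, ins p (ξ + e) B₃, ins p ξ C₃) :=
    ⟨_, rfl⟩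
  have hAux : spTκ p ξ e κ ρ xe xz yx yz zx ze = {T₁, T₂, T₃} := by
    rw [hT₁, hT₂, hT₃, hA₁, hB₁, hC₁, hA₂, hB₂, hC₂, hA₃, hB₃, hC₃]; rfl
  rw [hAux]
  refine ⟨glue p e {T₁, T₂, T₃} fun a' => if a' = ξ then Qξ else if a' = ξ + e then Qη else Qζ,
    ?_, fun t ht => mem_glue.2 (Or.inl ht), ?_⟩
  · refine isPMκ_glue hp he ?_ ?_ ?_ ?_ ?_ ?_ ?_ ?_
    · intro t ht
      simp only [mem_insert, mem_singleton] at ht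
      rcases ht with rfl | rfl | rfl
      · rw [hT₁]; exact (mk3_mem_frame hp).2 ⟨⟨n₃, n₂.symm, n₁⟩, R₁⟩
      · rw [hT₂]; exact (mk3_mem_frame hp).2 ⟨⟨n₁.symm, n₃, n₂⟩, R₂⟩
      · rw [hT₃]; exact (mk3_mem_frame hp).2 ⟨⟨n₂.symm, n₁.symm, n₃.symm⟩, R₃⟩
    · refine injOn_triple ?_ ?_ ?_ <;> simp [hT₁, hT₂, hT₃, n₁, n₂, n₃]
    · refine injOn_triple ?_ ?_ ?_ <;> simp [hT₁, hT₂, hT₃, n₁, n₂.symm, n₃.symm]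
    · refine injOn_triple ?_ ?_ ?_ <;> simp [hT₁, hT₂, hT₃, n₂, n₁.symm, n₃.symm]
    · intro t ht
      simp only [mem_insert, mem_singleton] at ht
      rcases ht with rfl | rfl | rfl
      · rw [hT₁]; simp [ins_eq_iff, hXe, hXz, n₁, n₃]
      · rw [hT₂]; simp [ins_eq_iff, hXe, hXz, G1.symm, n₂]
      · rw [hT₃]; simp [ins_eq_iff, hXe, hXz, G2.symm, n₂.symm]
    · intro t ht
      simp only [mem_insert, mem_singleton] at ht
      rcases ht with rfl | rfl | rfl
      · rw [hT₁]; simp [ins_eq_iff, hYx, hYz, G3.symm, n₃.symm]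
      · rw [hT₂]; simp [ins_eq_iff, hYx, hYz, G4.symm, n₃]
      · rw [hT₃]; simp [ins_eq_iff, hYx, hYz, n₂, n₁.symm]
    · intro t ht
      simp only [mem_insert, mem_singleton] at ht
      rcases ht with rfl | rfl | rfl
      · rw [hT₁]; simp [ins_eq_iff, hZx, hZe, G6.symm, n₁.symm]
      · rw [hT₂]; simp [ins_eq_iff, hZx, hZe, n₂.symm, n₃.symm]
      · rw [hT₃]; simp [ins_eq_iff, hZx, hZe, G5.symm, n₁]
    · intro a'
      rcases F3.cases3 ξ e a' he with rfl | rfl | rfl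
      · have e1 : layer p a' ({xe, xz} ∪ ({T₁, T₂, T₃} : Finset (Tr3 (m + 1))).image
            (fun t => t.1)) = {A₁} := by
          ext u; simp [hT₁, hT₂, hT₃, ins_eq_iff, hXe, hXz, n₁, n₃]
        have e2 : layer p (a' + e) ({yx, yz} ∪ ({T₁, T₂, T₃} : Finset (Tr3 (m + 1))).image
            (fun t => t.2.1)) = {B₃} := by
          ext u; simp [hT₁, hT₂, hT₃, ins_eq_iff, hYx, hYz, n₂, n₁.symm]
        have e3 : layer p (a' + e + e) ({zx, ze} ∪ ({T₁, T₂, T₃} : Finset (Tr3 (m + 1))).image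
            (fun t => t.2.2)) = {C₂} := by
          ext u; simp [hT₁, hT₂, hT₃, ins_eq_iff, hZx, hZe, n₂.symm, n₃.symm]
        rw [e1, e2, e3, if_pos rfl]
        exact hQξ
      · have e1 : layer p (ξ + e) ({xe, xz} ∪ ({T₁, T₂, T₃} : Finset (Tr3 (m + 1))).image
            (fun t => t.1)) = {tl p xe, A₂} := by
          ext u; simp [hT₁, hT₂, hT₃, ins_eq_iff, hXe, hXz, n₂, n₁.symm]; exact or_comm
        have e2 : layer p (ξ + e + e) ({yx, yz} ∪ ({T₁, T₂, T₃} : Finset (Tr3 (m + 1))).image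
            (fun t => t.2.1)) = {tl p yz, B₁} := by
          ext u; simp [hT₁, hT₂, hT₃, ins_eq_iff, hYx, hYz, n₂.symm, n₃.symm]; exact or_comm
        have e3 : layer p (ξ + e + e + e) ({zx, ze} ∪ ({T₁, T₂, T₃} : Finset (Tr3 (m + 1))).image
            (fun t => t.2.2)) = {tl p zx, C₃} := by
          ext u; simp [hT₁, hT₂, hT₃, ins_eq_iff, hZx, hZe, h3, n₁, n₃]
        rw [e1, e2, e3, if_neg n₁.symm, if_pos rfl]
        exact hQη
      · have e1 : layer p (ξ + e + e) ({xe, xz} ∪ ({T₁, T₂, T₃} : Finset (Tr3 (m + 1))).image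
            (fun t => t.1)) = {tl p xz, A₃} := by
          ext u; simp [hT₁, hT₂, hT₃, ins_eq_iff, hXe, hXz, n₂.symm, n₃.symm]
        have e2 : layer p (ξ + e + e + e) ({yx, yz} ∪ ({T₁, T₂, T₃} : Finset (Tr3 (m + 1))).image
            (fun t => t.2.1)) = {tl p yx, B₂} := by
          ext u; simp [hT₁, hT₂, hT₃, ins_eq_iff, hYx, hYz, h3, n₁, n₃]; exact or_comm
        have e3 : layer p (ξ + e + e + e + e) ({zx, ze} ∪
            ({T₁, T₂, T₃} : Finset (Tr3 (m + 1))).image (fun t => t.2.2)) = {tl p ze, C₁} := by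
          ext u; simp [hT₁, hT₂, hT₃, ins_eq_iff, hZx, hZe, h3, n₂, n₁.symm]; exact or_comm
        rw [e1, e2, e3, if_neg n₃.symm, if_neg n₂.symm]
        exact hQζ
  · intro t ht h2
    by_contra hA
    rw [glue_dir ht hA] at h2
    exact F3.dir_ne _ _ he h2

/-! ## §3 The SPREAD slice: two matchings -/

/-- SPREAD SLICE, oriented form, TWO MATCHINGS: the cores with the primary rule everywhere, resp.
the alternative rule at the permutation tail coordinate `j₀`, differ (their auxiliary triples are
intrinsic and the two tight rules differ at `j₀`, `spκ_diff`). -/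
theorem twoPMκ_spreadO {p : Fin (m + 1)} {κ : Fin (m + 1) → Bool} (hp : κ p = false)
    (hκ₁ : ∀ i j, tailκ p κ i = true → tailκ p κ j = true → i = j)
    (ih : ∀ x₁ x₂ y₁ y₂ z₁ z₂ : Word m, x₁ ≠ x₂ → y₁ ≠ y₂ → z₁ ≠ z₂ →
      (∀ j, lawκ (tailκ p κ j) (x₁ j) (x₂ j) (y₁ j) (y₂ j) (z₁ j) (z₂ j) = true) →
      ∃ P, isPMκ (tailκ p κ) P {x₁, x₂} {y₁, y₂} {z₁, z₂} = true)
    (j₀ : Fin m) (hj₀ : κ (p.succAbove j₀) = false) {ξ η ζ : Fin 3} (d₁ : ξ ≠ η) (d₂ : η ≠ ζ)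
    (d₃ : ξ ≠ ζ) {xe xz yx yz zx ze : Word (m + 1)} (hXe : xe p = η) (hXz : xz p = ζ)
    (hYx : yx p = ξ) (hYz : yz p = ζ) (hZx : zx p = ξ) (hZe : ze p = η)
    (hadm : ∀ i, lawκ (κ i) (xe i) (xz i) (yx i) (yz i) (zx i) (ze i) = true)
    (hsp : ∀ i, κ i = false → xe i ≠ xz i ∧ yx i ≠ yz i ∧ zx i ≠ ze i) :
    ∃ P₁ P₂, P₁ ≠ P₂ ∧ isPMκ κ P₁ {xe, xz} {yx, yz} {zx, ze} = true ∧
      isPMκ κ P₂ {xe, xz} {yx, yz} {zx, ze} = true := by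
  obtain ⟨he, hη, hζ, -, -, -, -⟩ := F3.spread_dirs ξ η ζ d₁ d₂ d₃
  rw [← hη] at hXe hZe
  rw [← hζ] at hXz hYz
  have hadm' := fun j => hadm (p.succAbove j)
  have hsp' := fun j => hsp (p.succAbove j)
  obtain ⟨P₁, h₁P, hS₁, -⟩ := spread_core hp hκ₁ ih j₀ hj₀ he (fun _ => false) hXe hXz hYx hYz
    hZx hZe hadm' hsp'
  obtain ⟨P₂, h₂P, -, hD₂⟩ := spread_core hp hκ₁ ih j₀ hj₀ he (fun j => decide (j = j₀)) hXe hXz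
    hYx hYz hZx hZe hadm' hsp'
  refine ⟨P₁, P₂, fun heq => ?_, h₁P, h₂P⟩
  obtain ⟨n₁, n₂, n₃⟩ := F3.lift_ne ξ (η - ξ) he
  have M : spTκ p ξ (η - ξ) κ (fun _ => false) xe xz yx yz zx ze ⊆
      spTκ p ξ (η - ξ) κ (fun j => decide (j = j₀)) xe xz yx yz zx ze :=
    fun t ht => hD₂ t (heq ▸ hS₁ ht) (spTκ_dir ht)
  simp only [spTκ, insert_subset_iff, singleton_subset_iff, mem_insert, mem_singleton,
    Prod.mk.injEq, ins_inj, n₁, n₂, n₃, n₁.symm, n₂.symm, n₃.symm, true_and, false_and,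
    and_false, or_false, false_or] at M
  obtain ⟨⟨eA₁, eB₁, eC₁⟩, ⟨eA₂, eB₂, eC₂⟩, ⟨eA₃, eB₃, eC₃⟩⟩ := M
  have L : twice (xe (p.succAbove j₀)) (xz (p.succAbove j₀)) (yx (p.succAbove j₀))
      (yz (p.succAbove j₀)) (zx (p.succAbove j₀)) (ze (p.succAbove j₀)) = true := by
    have h := hadm (p.succAbove j₀); rwa [hj₀] at h
  have ev : ∀ {f : Bool → Bool → Fin 3 → Fin 3 → Fin 3 → Fin 3 → Fin 3 → Fin 3 → Fin 3},
      puLet f p κ (fun _ => false) xe xz yx yz zx ze =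
        puLet f p κ (fun j => decide (j = j₀)) xe xz yx yz zx ze →
      f false false (xe (p.succAbove j₀)) (xz (p.succAbove j₀)) (yx (p.succAbove j₀))
        (yz (p.succAbove j₀)) (zx (p.succAbove j₀)) (ze (p.succAbove j₀)) =
      f false true (xe (p.succAbove j₀)) (xz (p.succAbove j₀)) (yx (p.succAbove j₀))
        (yz (p.succAbove j₀)) (zx (p.succAbove j₀)) (ze (p.succAbove j₀)) := by
    intro f e; simpa [hj₀] using congrFun e j₀
  exact spκ_diff _ _ _ _ _ _ L ((hsp _ hj₀).1) ((hsp _ hj₀).2.1) ((hsp _ hj₀).2.2)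
    ⟨ev eA₁, ev eB₁, ev eC₁, ev eA₂, ev eB₂, ev eC₂, ev eA₃, ev eB₃, ev eC₃⟩

/-- **SPREAD SLICE, TWO MATCHINGS** in a product frame: at a permutation pivot `p` where no pair
is doubled, provided no pair is doubled at ANY permutation coordinate (the pivot rule sends the
other configurations to the PURE / CROSSED slices), the complement has two distinct perfect
matchings.  Reduction to the oriented form by `…PowSubTwoRules.spread_letters`. -/
theorem twoPMκ_spread {p : Fin (m + 1)} {κ : Fin (m + 1) → Bool} (hp : κ p = false)
    (hκ₁ : ∀ i j, tailκ p κ i = true → tailκ p κ j = true → i = j)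
    (ih : ∀ x₁ x₂ y₁ y₂ z₁ z₂ : Word m, x₁ ≠ x₂ → y₁ ≠ y₂ → z₁ ≠ z₂ →
      (∀ j, lawκ (tailκ p κ j) (x₁ j) (x₂ j) (y₁ j) (y₂ j) (z₁ j) (z₂ j) = true) →
      ∃ P, isPMκ (tailκ p κ) P {x₁, x₂} {y₁, y₂} {z₁, z₂} = true)
    (j₀ : Fin m) (hj₀ : κ (p.succAbove j₀) = false) {x₁ x₂ y₁ y₂ z₁ z₂ : Word (m + 1)}
    (hadm : ∀ i, lawκ (κ i) (x₁ i) (x₂ i) (y₁ i) (y₂ i) (z₁ i) (z₂ i) = true)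
    (hsp : ∀ i, κ i = false → x₁ i ≠ x₂ i ∧ y₁ i ≠ y₂ i ∧ z₁ i ≠ z₂ i) :
    ∃ P₁ P₂, P₁ ≠ P₂ ∧ isPMκ κ P₁ {x₁, x₂} {y₁, y₂} {z₁, z₂} = true ∧
      isPMκ κ P₂ {x₁, x₂} {y₁, y₂} {z₁, z₂} = true := by
  have hlaw : twice (x₁ p) (x₂ p) (y₁ p) (y₂ p) (z₁ p) (z₂ p) = true := by
    have h := hadm p; rw [hp] at h; exact h
  obtain ⟨hd3, hxo, hyo, hzo⟩ :=
    spread_letters _ _ _ _ _ _ hlaw (hsp p hp).1 (hsp p hp).2.1 (hsp p hp).2.2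
  generalize -(x₁ p + x₂ p) = ξ at hd3 hyo hzo
  generalize -(y₁ p + y₂ p) = η at hd3 hxo hzo
  generalize -(z₁ p + z₂ p) = ζ at hd3 hxo hyo
  obtain ⟨d₁, d₂, d₃⟩ := hd3
  obtain ⟨xe, xz, hX, hXe, hXz, hadm₁, hsp₁⟩ : ∃ xe xz : Word (m + 1),
      ({x₁, x₂} : Finset (Word (m + 1))) = {xe, xz} ∧ xe p = η ∧ xz p = ζ ∧
      (∀ i, lawκ (κ i) (xe i) (xz i) (y₁ i) (y₂ i) (z₁ i) (z₂ i) = true) ∧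
      ∀ i, κ i = false → xe i ≠ xz i ∧ y₁ i ≠ y₂ i ∧ z₁ i ≠ z₂ i := by
    rcases hxo with ⟨e₁, e₂⟩ | ⟨e₁, e₂⟩
    · exact ⟨x₁, x₂, rfl, e₁, e₂, hadm, hsp⟩
    · exact ⟨x₂, x₁, pair_comm _ _, e₁, e₂, fun i => lawκ_swap_x _ _ _ _ _ _ _ (hadm i),
        fun i hi => ⟨((hsp i hi).1).symm, (hsp i hi).2⟩⟩
  obtain ⟨yx, yz, hY, hYx, hYz, hadm₂, hsp₂⟩ : ∃ yx yz : Word (m + 1),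
      ({y₁, y₂} : Finset (Word (m + 1))) = {yx, yz} ∧ yx p = ξ ∧ yz p = ζ ∧
      (∀ i, lawκ (κ i) (xe i) (xz i) (yx i) (yz i) (z₁ i) (z₂ i) = true) ∧
      ∀ i, κ i = false → xe i ≠ xz i ∧ yx i ≠ yz i ∧ z₁ i ≠ z₂ i := by
    rcases hyo with ⟨e₁, e₂⟩ | ⟨e₁, e₂⟩
    · exact ⟨y₁, y₂, rfl, e₁, e₂, hadm₁, hsp₁⟩
    · exact ⟨y₂, y₁, pair_comm _ _, e₁, e₂, fun i => lawκ_swap_y _ _ _ _ _ _ _ (hadm₁ i),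
        fun i hi => ⟨(hsp₁ i hi).1, ((hsp₁ i hi).2.1).symm, (hsp₁ i hi).2.2⟩⟩
  obtain ⟨zx, ze, hZ, hZx, hZe, hadm₃, hsp₃⟩ : ∃ zx ze : Word (m + 1),
      ({z₁, z₂} : Finset (Word (m + 1))) = {zx, ze} ∧ zx p = ξ ∧ ze p = η ∧
      (∀ i, lawκ (κ i) (xe i) (xz i) (yx i) (yz i) (zx i) (ze i) = true) ∧
      ∀ i, κ i = false → xe i ≠ xz i ∧ yx i ≠ yz i ∧ zx i ≠ ze i := by
    rcases hzo with ⟨e₁, e₂⟩ | ⟨e₁, e₂⟩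
    · exact ⟨z₁, z₂, rfl, e₁, e₂, hadm₂, hsp₂⟩
    · exact ⟨z₂, z₁, pair_comm _ _, e₁, e₂, fun i => lawκ_swap_z _ _ _ _ _ _ _ (hadm₂ i),
        fun i hi => ⟨(hsp₂ i hi).1, (hsp₂ i hi).2.1, ((hsp₂ i hi).2.2).symm⟩⟩
  rw [hX, hY, hZ]
  exact twoPMκ_spreadO hp hκ₁ ih j₀ hj₀ d₁ d₂ d₃ hXe hXz hYx hYz hZx hZe hadm₃ hsp₃

end Summit.MatrixMultiplication.MatrixMultiplication.Theorems.OutsiderSandwichToricCeilingPowMixedSpread
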